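import Literature.Analysis.ODE.GrowthChain
import Mathlib.Analysis.SpecialFunctions.Pow.Real
import HarnessLib

/-!
# Inward growth of a flux-carrying solution through a barrier: two-point decay relative to the
# value at the inner end, from data at the outer end only

Topic `Literature/Analysis/ODE` (namespace `Literature.Analysis.ODE`), continuing
`RecessiveDominance.lean`. Setting: the REAL equation `y″ = q(x) y` on a forbidden interval `[α, β]`,
its two-end real basis `g` (`g(α) = 1`, `g′(α) = 0`), `d` (`d(β) = 1`, `d′(β) = 0`), `w₀ = g′(β) > 0`,
`g d′ − g′ d ≡ −w₀` (`BarrierBasis.exists_barrierBasis`), and a COMPLEX solution `v` known only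
through its data at the RIGHT end: `‖v′(β)‖ ≤ P₁` and the flux `Im(v̄ v′)(β) = F ≠ 0` (the
infinity-normalised solution of a radial wave equation entering the barrier at its outer turning
point). Over the basis `v = a g + b d` with `a w₀ = v′(β)`, and the flux forces `|F| ≤ |a||b| w₀`, so

  `|a| ≤ (P₁²/(|F| w₀))·|b|`:

once `2P₁² ≤ |F| w₀` the growing component is at most half of the recessive one AT THE INNER END,
`‖v(α)‖ ≥ ½|b| d(α)`. Consequences (no envelope of `v` to the left of `β` is used):

* `norm_mul_le_of_right_flux` — for `x ∈ [α, β]`: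
  `‖v(x)‖·d(α) ≤ 2·(d(x) + (P₁²/(|F| w₀))·g(x))·‖v(α)‖`; dividing by `d(x) ≥ 1` the two-point ratio
  `‖v(x)‖/‖v(α)‖` is at most `2(1 + P₁² g(β)/(|F| w₀))` times the DECAY `d(x)/d(α)` of the recessive
  branch;
* `abs_flux_mul_le_of_right_flux` — `|F|·d(α) ≤ 2P₁·‖v(α)‖`: the inner value dominates the whole
  growth `d(α)` of the recessive branch (for points beyond `β`, where `v` is bounded by a far envelope);
* `mul_rpow_le_mul_rpow_of_rate` — the integrated form of a certified recessive rate against a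
  weight `r > 0`: if `(p·r′/r)·d ≤ −d′` on `[a, b]` then `d(b)·r(b)^p ≤ d(a)·r(a)^p` (`log d + p log r`
  is non-increasing), turning the pointwise rates of `RecessiveRate.tanh_mul_le_neg_deriv` for an
  inverse-square coefficient `q ≥ (c/r)²` into the power decay `d(x)/d(α) ≤ (r(α)/r(x))^p`.

Used for the decay of the cone Green kernel across the ANGULAR barrier of Carter's radial equation
(near-extremal Kerr programme): far source points see the near zone only through a factor
`(R_b/r′)^{c√Λ}`. Everything here is one-interval real analysis plus one-point algebra; all proved.

## References
* P. Hartman, *Ordinary Differential Equations* (SIAM Classics 38, 2002), Ch. XI §§2, 6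
  (Wronskian identities; principal/recessive solutions). Key `Hartman2002`.
* S. Agmon, *Lectures on Exponential Decay of Solutions of Second-Order Elliptic Equations*,
  Princeton Math. Notes 29 (1982), Ch. 1 (the weight `e^{∫√q}`). The assembly is folklore.
-/

noncomputable section

open Set
open scoped ComplexConjugate

namespace Literature.Analysis.ODE

/-! ### The coefficients of a right-flux solution over the barrier basis -/

/-- **Coefficient bounds from the right data.** On `[α, β]` let `g, d` be real solutions of
`y″ = q y` with `g(α) = 1`, `d(β) = 1`, `d′(β) = 0`, `g′(β) = w₀ > 0`, `g d′ − g′ d ≡ −w₀`, `d(α) ≥ 1`,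
and let `v` be a complex solution with `‖v′(β)‖ ≤ P₁`, flux `Im(v̄(β) v′(β)) = F ≠ 0` and DEPTH
`2P₁² ≤ |F| w₀`. Then `v = a g + b d` on `[α, β]` with `|a| ≤ (P₁²/(|F| w₀))·|b|`, `|b|·d(α) ≤ 2‖v(α)‖`
and `|F| ≤ P₁·|b|`. [folklore] -/
theorem coeffs_of_right_flux {q g g' d d' : ℝ → ℝ} {v v' : ℝ → ℂ} {α β w₀ F P₁ : ℝ}
    (hαβ : α ≤ β) (hw₀ : 0 < w₀)
    (hg : ∀ x ∈ Icc α β, HasDerivAt g (g' x) x ∧ HasDerivAt g' (q x * g x) x)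
    (hd : ∀ x ∈ Icc α β, HasDerivAt d (d' x) x ∧ HasDerivAt d' (q x * d x) x)
    (hgα : g α = 1) (hdβ : d β = 1) (hd'β : d' β = 0) (hg'β : g' β = w₀)
    (hW : ∀ x ∈ Icc α β, g x * d' x - g' x * d x = -w₀) (hdα : 1 ≤ d α)
    (hv : ∀ x ∈ Icc α β, HasDerivAt v (v' x) x ∧ HasDerivAt v' ((q x : ℂ) * v x) x)
    (hF : (conj (v β) * v' β).im = F) (hF0 : F ≠ 0) (hP₁ : ‖v' β‖ ≤ P₁)
    (hdeep : 2 * P₁ ^ 2 ≤ |F| * w₀) :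
    ∃ a b : ℂ, (∀ x ∈ Icc α β, v x = a * g x + b * d x ∧ v' x = a * g' x + b * d' x) ∧
      ‖a‖ ≤ P₁ ^ 2 / (|F| * w₀) * ‖b‖ ∧ ‖b‖ * d α ≤ 2 * ‖v α‖ ∧ |F| ≤ P₁ * ‖b‖ := by
  have hα : α ∈ Icc α β := left_mem_Icc.2 hαβ
  have hβ : β ∈ Icc α β := right_mem_Icc.2 hαβ
  have hwC : (w₀ : ℂ) ≠ 0 := Complex.ofReal_ne_zero.2 hw₀.ne'
  have hFpos : 0 < |F| := abs_pos.2 hF0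
  -- coefficients from the right data
  set a : ℂ := v' β / w₀ with ha
  set b : ℂ := v β - a * g β with hb
  have ha' : a * w₀ = v' β := by rw [ha]; exact div_mul_cancel₀ _ hwC
  have hb' : a * g β + b = v β := by rw [hb]; ring
  have hrep : ∀ x ∈ Icc α β, v x = a * g x + b * d x ∧ v' x = a * g' x + b * d' x :=
    fun x hx ↦ eq_mul_add_of_right_data hv hg hd hdβ hd'β hg'β hw₀.ne' hW ha' hb' hx
  -- the flux at `β`: `|F| ≤ |a||b| w₀`
  have hflux : |F| ≤ ‖a‖ * ‖b‖ * w₀ := by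
    have h := abs_flux_combination_le a b (g β) (g' β) (d β) (d' β)
    rw [← (hrep β hβ).1, ← (hrep β hβ).2, hF, hdβ, hd'β, hg'β, mul_zero, one_mul, zero_sub,
      abs_neg, abs_of_pos hw₀] at h
    exact h
  -- `|a| ≤ P₁/w₀`
  have haP : ‖a‖ ≤ P₁ / w₀ := by
    rw [ha, norm_div, Complex.norm_of_nonneg hw₀.le]
    exact div_le_div_of_nonneg_right hP₁ hw₀.le
  have hP₁0 : 0 ≤ P₁ := (norm_nonneg _).trans hP₁
  -- `|F| ≤ P₁ |b|`
  have hFb : |F| ≤ P₁ * ‖b‖ := by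
    calc |F| ≤ ‖a‖ * ‖b‖ * w₀ := hflux
      _ ≤ P₁ / w₀ * ‖b‖ * w₀ := by gcongr
      _ = P₁ * ‖b‖ := by field_simp
  -- `|a| ≤ (P₁²/(|F| w₀)) |b|`: `|a|·|F| ≤ |a|²|b| w₀ ≤ (P₁/w₀)²|b| w₀`
  have hab : ‖a‖ ≤ P₁ ^ 2 / (|F| * w₀) * ‖b‖ := by
    have h1 : ‖a‖ * |F| ≤ (P₁ / w₀) ^ 2 * ‖b‖ * w₀ := by
      calc ‖a‖ * |F| ≤ ‖a‖ * (‖a‖ * ‖b‖ * w₀) := mul_le_mul_of_nonneg_left hflux (norm_nonneg _)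
        _ = ‖a‖ ^ 2 * ‖b‖ * w₀ := by ring
        _ ≤ (P₁ / w₀) ^ 2 * ‖b‖ * w₀ := by gcongr
    rw [div_mul_eq_mul_div, le_div_iff₀ (mul_pos hFpos hw₀)]
    calc ‖a‖ * (|F| * w₀) = ‖a‖ * |F| * w₀ := by ring
      _ ≤ (P₁ / w₀) ^ 2 * ‖b‖ * w₀ * w₀ := mul_le_mul_of_nonneg_right h1 hw₀.le
      _ = P₁ ^ 2 * ‖b‖ := by field_simp
  -- `P₁²/(|F| w₀) ≤ 1/2`
  have hΘ : P₁ ^ 2 / (|F| * w₀) ≤ 1 / 2 := by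
    rw [div_le_iff₀ (mul_pos hFpos hw₀)]; linarith
  -- `|b| d(α) ≤ ‖v α‖ + |a| ≤ ‖v α‖ + ½|b| ≤ ‖v α‖ + ½|b| d(α)`
  have hbd : ‖b‖ * d α ≤ 2 * ‖v α‖ := by
    have h1 : ‖b‖ * d α ≤ ‖v α‖ + ‖a‖ := by
      have e : b * d α = v α - a := by rw [(hrep α hα).1, hgα]; push_cast; ring
      have hdn : 0 ≤ d α := zero_le_one.trans hdα
      calc ‖b‖ * d α = ‖b * d α‖ := by rw [norm_mul, Complex.norm_of_nonneg hdn]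
        _ = ‖v α - a‖ := by rw [e]
        _ ≤ ‖v α‖ + ‖a‖ := norm_sub_le _ _
    have h2 : ‖a‖ ≤ 1 / 2 * ‖b‖ := hab.trans (mul_le_mul_of_nonneg_right hΘ (norm_nonneg _))
    have h3 : ‖b‖ ≤ ‖b‖ * d α := le_mul_of_one_le_right (norm_nonneg _) hdα
    linarith
  exact ⟨a, b, hrep, hab, hbd, hFb⟩

/-- **Two-point bound from the right data.** In the setting of `coeffs_of_right_flux` with moreover
`g ≥ 0`, `d ≥ 0` on `[α, β]`: for every `x ∈ [α, β]`,
`‖v(x)‖·d(α) ≤ 2·(d(x) + (P₁²/(|F| w₀))·g(x))·‖v(α)‖` — the value of `v` at an interior point is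
controlled by its value at the INNER end `α` through the decay `d(x)/d(α)` of the recessive branch,
up to the (small) growing admixture `(P₁²/(|F| w₀))·g(x)/d(α)`. [folklore] -/
theorem norm_mul_le_of_right_flux {q g g' d d' : ℝ → ℝ} {v v' : ℝ → ℂ} {α β w₀ F P₁ : ℝ}
    (hαβ : α ≤ β) (hw₀ : 0 < w₀)
    (hg : ∀ x ∈ Icc α β, HasDerivAt g (g' x) x ∧ HasDerivAt g' (q x * g x) x)
    (hd : ∀ x ∈ Icc α β, HasDerivAt d (d' x) x ∧ HasDerivAt d' (q x * d x) x)
    (hgα : g α = 1) (hdβ : d β = 1) (hd'β : d' β = 0) (hg'β : g' β = w₀)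
    (hW : ∀ x ∈ Icc α β, g x * d' x - g' x * d x = -w₀) (hdα : 1 ≤ d α)
    (hsign : ∀ x ∈ Icc α β, 0 ≤ g x ∧ 0 ≤ d x)
    (hv : ∀ x ∈ Icc α β, HasDerivAt v (v' x) x ∧ HasDerivAt v' ((q x : ℂ) * v x) x)
    (hF : (conj (v β) * v' β).im = F) (hF0 : F ≠ 0) (hP₁ : ‖v' β‖ ≤ P₁)
    (hdeep : 2 * P₁ ^ 2 ≤ |F| * w₀) {x : ℝ} (hx : x ∈ Icc α β) :
    ‖v x‖ * d α ≤ 2 * (d x + P₁ ^ 2 / (|F| * w₀) * g x) * ‖v α‖ := by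
  obtain ⟨a, b, hrep, hab, hbd, -⟩ :=
    coeffs_of_right_flux hαβ hw₀ hg hd hgα hdβ hd'β hg'β hW hdα hv hF hF0 hP₁ hdeep
  obtain ⟨hgx, hdx⟩ := hsign x hx
  have hΘ0 : 0 ≤ P₁ ^ 2 / (|F| * w₀) := by positivity
  -- `‖v x‖ ≤ |a| g x + |b| d x ≤ |b| (Θ g x + d x)`
  have h1 : ‖v x‖ ≤ ‖b‖ * (d x + P₁ ^ 2 / (|F| * w₀) * g x) := by
    calc ‖v x‖ = ‖a * g x + b * d x‖ := by rw [(hrep x hx).1]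
      _ ≤ ‖a‖ * g x + ‖b‖ * d x := norm_mul_ofReal_add_le a b hgx hdx
      _ ≤ P₁ ^ 2 / (|F| * w₀) * ‖b‖ * g x + ‖b‖ * d x := by gcongr
      _ = ‖b‖ * (d x + P₁ ^ 2 / (|F| * w₀) * g x) := by ring
  have h0 : 0 ≤ d x + P₁ ^ 2 / (|F| * w₀) * g x := by positivity
  have hdn : 0 ≤ d α := zero_le_one.trans hdα
  calc ‖v x‖ * d α ≤ ‖b‖ * (d x + P₁ ^ 2 / (|F| * w₀) * g x) * d α :=
        mul_le_mul_of_nonneg_right h1 hdn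
    _ = (d x + P₁ ^ 2 / (|F| * w₀) * g x) * (‖b‖ * d α) := by ring
    _ ≤ (d x + P₁ ^ 2 / (|F| * w₀) * g x) * (2 * ‖v α‖) := mul_le_mul_of_nonneg_left hbd h0
    _ = 2 * (d x + P₁ ^ 2 / (|F| * w₀) * g x) * ‖v α‖ := by ring

/-- **The inner value dominates the total growth of the recessive branch.** In the setting of
`coeffs_of_right_flux`: `|F|·d(α) ≤ 2P₁·‖v(α)‖`. [folklore] -/
theorem abs_flux_mul_le_of_right_flux {q g g' d d' : ℝ → ℝ} {v v' : ℝ → ℂ} {α β w₀ F P₁ : ℝ}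
    (hαβ : α ≤ β) (hw₀ : 0 < w₀)
    (hg : ∀ x ∈ Icc α β, HasDerivAt g (g' x) x ∧ HasDerivAt g' (q x * g x) x)
    (hd : ∀ x ∈ Icc α β, HasDerivAt d (d' x) x ∧ HasDerivAt d' (q x * d x) x)
    (hgα : g α = 1) (hdβ : d β = 1) (hd'β : d' β = 0) (hg'β : g' β = w₀)
    (hW : ∀ x ∈ Icc α β, g x * d' x - g' x * d x = -w₀) (hdα : 1 ≤ d α)
    (hv : ∀ x ∈ Icc α β, HasDerivAt v (v' x) x ∧ HasDerivAt v' ((q x : ℂ) * v x) x)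
    (hF : (conj (v β) * v' β).im = F) (hF0 : F ≠ 0) (hP₁ : ‖v' β‖ ≤ P₁)
    (hdeep : 2 * P₁ ^ 2 ≤ |F| * w₀) :
    |F| * d α ≤ 2 * P₁ * ‖v α‖ := by
  obtain ⟨a, b, -, -, hbd, hFb⟩ :=
    coeffs_of_right_flux hαβ hw₀ hg hd hgα hdβ hd'β hg'β hW hdα hv hF hF0 hP₁ hdeep
  have hP₁0 : 0 ≤ P₁ := (norm_nonneg _).trans hP₁
  have hdn : 0 ≤ d α := zero_le_one.trans hdα
  calc |F| * d α ≤ P₁ * ‖b‖ * d α := mul_le_mul_of_nonneg_right hFb hdn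
    _ = P₁ * (‖b‖ * d α) := by ring
    _ ≤ P₁ * (2 * ‖v α‖) := mul_le_mul_of_nonneg_left hbd hP₁0
    _ = 2 * P₁ * ‖v α‖ := by ring

/-! ### Integrated recessive rate against a weight -/

/-- **Integrated recessive rate against a weight.** On `[a, b]` let `d > 0` have derivative `d′`,
let the weight `r > 0` have derivative `r′`, and suppose the pointwise rate `(p·r′(s)/r(s))·d(s) ≤ −d′(s)`
(for instance `p/r(s)` below a certified recessive rate `−d′/d`, cf.
`RecessiveRate.tanh_mul_le_neg_deriv`, and `r′ ≤ 1`). Then `d(b)·r(b)^p ≤ d(a)·r(a)^p`: the function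
`log d + p·log r` is non-increasing on `[a, b]`. [folklore] -/
theorem mul_rpow_le_mul_rpow_of_rate {d d' r r' : ℝ → ℝ} {a b p : ℝ} (hab : a ≤ b)
    (hd : ∀ s ∈ Icc a b, HasDerivAt d (d' s) s) (hr : ∀ s ∈ Icc a b, HasDerivAt r (r' s) s)
    (hd0 : ∀ s ∈ Icc a b, 0 < d s) (hr0 : ∀ s ∈ Icc a b, 0 < r s)
    (hrate : ∀ s ∈ Icc a b, p * r' s / r s * d s ≤ -d' s) :
    d b * r b ^ p ≤ d a * r a ^ p := by
  set Φ : ℝ → ℝ := fun s ↦ Real.log (d s) + p * Real.log (r s) with hΦ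
  have hΦ' : ∀ s ∈ Icc a b, HasDerivAt Φ (d' s / d s + p * (r' s / r s)) s := fun s hs ↦ by
    have h1 : HasDerivAt (fun y ↦ Real.log (d y)) (d' s / d s) s := by
      simpa only [div_eq_inv_mul] using (hd s hs).log (hd0 s hs).ne'
    have h2 : HasDerivAt (fun y ↦ Real.log (r y)) (r' s / r s) s := by
      simpa only [div_eq_inv_mul] using (hr s hs).log (hr0 s hs).ne'
    exact h1.add (h2.const_mul p)
  have hanti : AntitoneOn Φ (Icc a b) :=
    antitoneOn_of_deriv_nonpos (convex_Icc a b)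
      (fun s hs ↦ (hΦ' s hs).continuousAt.continuousWithinAt)
      (fun s hs ↦ (hΦ' s (interior_subset hs)).differentiableAt.differentiableWithinAt)
      fun s hs ↦ by
        have hs' : s ∈ Icc a b := interior_subset hs
        rw [(hΦ' s hs').deriv]
        have hds := hd0 s hs'
        have hrs := hr0 s hs'
        have h1 : p * r' s / r s ≤ -d' s / d s := by
          rw [le_div_iff₀ hds]; exact hrate s hs'
        have e : d' s / d s + p * (r' s / r s) = p * r' s / r s - -d' s / d s := by ring
        rw [e]; linarith
  have key : Φ b ≤ Φ a := hanti (left_mem_Icc.2 hab) (right_mem_Icc.2 hab) hab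
  have hexp : ∀ s ∈ Icc a b, Real.exp (Φ s) = d s * r s ^ p := fun s hs ↦ by
    show Real.exp (Real.log (d s) + p * Real.log (r s)) = d s * r s ^ p
    rw [Real.exp_add, Real.exp_log (hd0 s hs), Real.rpow_def_of_pos (hr0 s hs), mul_comm (Real.log _)]
  rw [← hexp b (right_mem_Icc.2 hab), ← hexp a (left_mem_Icc.2 hab)]
  exact Real.exp_le_exp.2 key

end Literature.Analysis.ODE

end
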